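import Literature.AlgebraicGeometry.Motives.AbelianVarietyInvariantHomRank
import HarnessLib

/-!
# Permutation powers `A^S = A ⊗ ℤ[S]` of an abelian variety: the permutation action of `G` on `A^S`, equivariant
# homomorphisms between powers as ORBIT MATRICES, and `rk_ℤ Hom_G(A^S, B^T) = |G\(S × T)| · rk_ℤ Hom(A, B)`

Let `A` be an abelian variety over a field `K` and `S` a finite set.  A power `X = A^S` is recorded, as everywhere in this part
of the tree for biproducts, by a bicone `b` over the constant family `(A)_{s ∈ S}` — projections `π_s : X → A`, injections
`ι_s : A → X`, `ι_s ≫ π_t = δ_{s,t}` — together with the identity **`Σ_s π_s ≫ ι_s = 𝟙_X`** (`hb`), which makes `X` a biproduct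
`⨁_{s ∈ S} A` (Mathlib `Bicone.isBilimitOfTotal`; Mumford §19: `Hom(C, A^S) = Hom(C, A)^S`, `Hom(A^S, C) = Hom(A, C)^S`).  This is
the Serre–Tate **power object** `𝓗𝓞𝓜_ℤ(ℤ^S, A)` of Jordan–Keeton–Poonen–Rains–Shepherd-Barron–Tate §4.1:
`Hom(C, 𝓗𝓞𝓜_R(M, A)) = Hom_R(M, Hom(C, A))` with `R = ℤ`, `M = ℤ^S`.  When a group `G` acts on `S`, the **permutation
action** of `G` on `A^S` (Serre §1.2 (c): `ρ_s e_x = e_{sx}`) is an action `ρ : G → End X` with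

  **`ι_s ≫ ρ(g) = ι_{g s}`**   (`hρ`; equivalently `ρ(g) ≫ π_{g t} = π_t`, `ρ(g) = Σ_s π_s ≫ ι_{g s}`),

i.e. `X = 𝓗𝓞𝓜_ℤ(ℤ[S], A) = A ⊗_ℤ ℤ[S]` with `G` acting through the permutation module `ℤ[S]` (which is self-dual).  This file
proves, with NO new definition (the action enters as the hypothesis `hρ`; §2 shows such a `ρ` EXISTS and is UNIQUE for every
power, so the hypothesis is not vacuous):

* §1 the component calculus along `b` (expansion `f = Σ_{s,t} π_s ≫ f_{s t} ≫ ι_t`, `f_{s t} = ι_s ≫ f ≫ π_t`; extensionality by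
  components; components of a matrix `Σ_s π_s ≫ Σ_t m_{s t} ≫ ι_t`);
* §2 the permutation action: `ρ(g) = Σ_s π_s ≫ ι_{g s}`, `ρ(g) ≫ π_t = π_{g⁻¹ t}`, its matrix `ι_s ≫ ρ(g) ≫ π_t = δ_{g s, t}`,
  **existence** (`exists_permAction`) and **uniqueness** (`permAction_unique`);
* §3 the EQUIVARIANCE CRITERIA: for `G` acting on `X'` by `ρ'` and on the powers `A^S`, `B^T` by permutations,
  `f : X' → A^T` is equivariant iff **`ρ'(g) ≫ f_{g t} = f_t`** (`f_t = f ≫ π_t`), `f : A^S → X'` is equivariant iff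
  **`f^{g s} = f^s ≫ ρ'(g)`** (`f^s = ι_s ≫ f`), and `f : A^S → B^T` is equivariant iff its matrix is CONSTANT ON THE `G`-ORBITS
  of `S × T`: **`f_{g s, g t} = f_{s, t}`** (Serre Ex. 2.6 (b): the diagonal action on `X × X`; the universal property of the
  power object in the category of `G`-objects: `Hom_G(C, 𝓗𝓞𝓜(ℤ[T], A)) = Hom_{ℤ[G]}(ℤ[T], Hom(C, A))`);
* §4 the RANK FORMULAS (`Hom(A, B)` is free of finite rank, Mumford §19 Thm. 3):
  **`rk_ℤ Hom_G(A^S, B^T) = |G\(S × T)| · rk_ℤ Hom(A, B)`** (`finrank_equivariantHom_permPower_eq` — orbit matrices; for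
  `S = G/H`, `T = G/K` the orbit count is the number of double cosets `|H\G/K|`, Mackey),
  **`rk_ℤ Hom(A^S, Y)^G = |G\S| · rk_ℤ Hom(A, Y)`** for the `G`-invariant homomorphisms `{f | ρ(g) ≫ f = f}` out of a permutation
  power (`finrank_hom_permPower_source_invariant_eq`: "homomorphisms constant on orbits are homomorphisms out of `A^{S/G}`";
  compare the general bound `≤ 4 dim B_G dim Y` of `Motives/AbelianVarietyInvariantHomRank`), and
  **`rk_ℤ {f : X' → B^T | f ≫ ρ(g) = f} = |G\T| · rk_ℤ Hom(X', B)`** (`finrank_hom_permPower_target_invariant_eq`).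

Scope (stated, not hidden).  `S`, `T` finite; `G` arbitrary (finiteness is not needed: orbits of `G` on a finite set); the
permutation action is by the hypothesis `hρ` on a given `ρ : G →* End X`; `Hom_G` is the `⨅_g eqLocus` submodule of
`Motives/AbelianVarietyEquivariantHomCharacterBound`; no Tate modules, no isogenies, any field `K`.

## References

* [SerreLinearRepresentations1977] J.-P. Serre, *Linear Representations of Finite Groups*, GTM 42 (1977): §1.2 (c) (permutation
  representation `ρ_s e_x = e_{sx}`), §2.3 Ex. 2.6 (a), (b) (orbits; the diagonal action on `X × X`), §3.3 Ex. 2 (the permutation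
  representation on `G/H` is induced from the unit representation), §7.3 Prop. 22 (double cosets).  Held:
  `book:serre1977-linear-representations-finite-groups`, pp. 10, 20, 30, 53 read.
* [JordanEtAl2018] B. W. Jordan, A. G. Keeton, B. Poonen, E. M. Rains, N. Shepherd-Barron, J. T. Tate,
  *Abelian varieties isogenous to a power of an elliptic curve*, Compos. Math. 154 (2018), §4.1 (the functor `𝓗𝓞𝓜_R(−, E)`:
  `Hom(C, 𝓗𝓞𝓜_R(M, E)) ≅ Hom_R(M, Hom(C, E))`, functorial in `C`; construction of Serre and Tate).  arXiv:1602.06237, p. 7 read.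
* [MumfordAV1970] D. Mumford, *Abelian Varieties* (1970), §19 Thm. 3 (p. 176: `Hom(X, Y)` is a free `ℤ`-module of finite rank) and
  the additivity `Hom(X₁ × X₂, Y) = Hom(X₁, Y) ⊕ Hom(X₂, Y)` (p. 173).
* [Milne1986AbelianVarieties] J. S. Milne, *Abelian varieties*, in Cornell–Silverman (1986), §12 Lemma 12.2 (p. 189).
-/

noncomputable section

open CategoryTheory CategoryTheory.Limits
open Literature.NumberTheory.DiophantineGeometry

universe u

namespace Literature.AlgebraicGeometry.Motives

namespace AbelianVariety

variable {K : Type u} [Field K]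

/-! ## §1 Components along a power `X = A^S` (a bicone with `Σ_s π_s ≫ ι_s = 𝟙`) -/

section Components

variable {A X' Y : AbelianVariety K} {S : Type} [Fintype S] (b : Bicone (fun _ : S ↦ A))

omit [Fintype S] in
/-- `ι_s ≫ π_t = δ_{s,t}` on a power of ONE abelian variety (the bicone relation, with `eqToHom rfl = 𝟙`).
[cite: MumfordAV1970, §19 (p. 173: `Hom(X₁ × X₂, Y) = Hom(X₁, Y) ⊕ Hom(X₂, Y)`)] -/
theorem bicone_ι_π_eq_ite [DecidableEq S] (s t : S) : b.ι s ≫ b.π t = if s = t then 𝟙 A else 0 := by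
  by_cases h : s = t
  · subst h
    rw [if_pos rfl]
    exact bicone_ι_π_self b s
  · rw [if_neg h]
    exact bicone_ι_π_ne b h

/-- `(Σ_s x_s ≫ ι_s) ≫ π_t = x_t`: the `t`-th component of the map INTO the power with components `x`.
[cite: MumfordAV1970, §19 (p. 173)] -/
theorem sum_comp_ι_comp_π (x : S → (X' ⟶ A)) (t : S) : (∑ s, x s ≫ b.ι s) ≫ b.π t = x t := by
  rw [Preadditive.sum_comp, Finset.sum_eq_single t]
  · rw [Category.assoc, bicone_ι_π_self]
    exact Category.comp_id _
  · intro s _ hst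
    rw [Category.assoc, bicone_ι_π_ne b hst, comp_zero]
  · intro h
    exact absurd (Finset.mem_univ t) h

/-- `ι_s ≫ (Σ_t π_t ≫ y_t) = y_s`: the `s`-th component of the map OUT OF the power with components `y`.
[cite: MumfordAV1970, §19 (p. 173)] -/
theorem ι_comp_sum_π_comp (y : S → (A ⟶ Y)) (s : S) : b.ι s ≫ (∑ t, b.π t ≫ y t) = y s := by
  rw [Preadditive.comp_sum, Finset.sum_eq_single s]
  · rw [← Category.assoc, bicone_ι_π_self]
    exact Category.id_comp _
  · intro t _ hts
    rw [← Category.assoc, bicone_ι_π_ne b (Ne.symm hts), zero_comp]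
  · intro h
    exact absurd (Finset.mem_univ s) h

/-- **Expansion of a map into a power by its components**: `f = Σ_s (f ≫ π_s) ≫ ι_s` (uses `Σ_s π_s ≫ ι_s = 𝟙`).
[cite: MumfordAV1970, §19 (p. 173)] [cite: JordanEtAl2018, §4.1 (`Hom(C, 𝓗𝓞𝓜_R(M, E)) ≅ Hom_R(M, Hom(C, E))`)] -/
theorem eq_sum_comp_π_comp_ι (hb : ∑ s, b.π s ≫ b.ι s = 𝟙 b.pt) (f : X' ⟶ b.pt) :
    f = ∑ s, (f ≫ b.π s) ≫ b.ι s := by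
  conv_lhs => rw [← Category.comp_id f, ← hb, Preadditive.comp_sum]
  simp only [Category.assoc]

/-- **Expansion of a map out of a power by its components**: `f = Σ_s π_s ≫ (ι_s ≫ f)`. [cite: MumfordAV1970, §19 (p. 173)] -/
theorem eq_sum_π_comp_ι_comp (hb : ∑ s, b.π s ≫ b.ι s = 𝟙 b.pt) (f : b.pt ⟶ Y) :
    f = ∑ s, b.π s ≫ b.ι s ≫ f := by
  conv_lhs => rw [← Category.id_comp f, ← hb, Preadditive.sum_comp]
  simp only [Category.assoc]

/-- Maps INTO a power are determined by their components `f ≫ π_s`. [cite: MumfordAV1970, §19 (p. 173)] -/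
theorem hom_ext_π (hb : ∑ s, b.π s ≫ b.ι s = 𝟙 b.pt) {f g : X' ⟶ b.pt} (h : ∀ s, f ≫ b.π s = g ≫ b.π s) : f = g := by
  calc f = ∑ s, (f ≫ b.π s) ≫ b.ι s := eq_sum_comp_π_comp_ι b hb f
    _ = ∑ s, (g ≫ b.π s) ≫ b.ι s := by simp only [h]
    _ = g := (eq_sum_comp_π_comp_ι b hb g).symm

/-- Maps OUT OF a power are determined by their components `ι_s ≫ f`. [cite: MumfordAV1970, §19 (p. 173)] -/
theorem hom_ext_ι (hb : ∑ s, b.π s ≫ b.ι s = 𝟙 b.pt) {f g : b.pt ⟶ Y} (h : ∀ s, b.ι s ≫ f = b.ι s ≫ g) : f = g := by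
  calc f = ∑ s, b.π s ≫ b.ι s ≫ f := eq_sum_π_comp_ι_comp b hb f
    _ = ∑ s, b.π s ≫ b.ι s ≫ g := by simp only [h]
    _ = g := (eq_sum_π_comp_ι_comp b hb g).symm

variable {B : AbelianVariety K} {T : Type} [Fintype T] (c : Bicone (fun _ : T ↦ B))

/-- **The matrix of a map between powers**: `f = Σ_s π_s ≫ Σ_t f_{s t} ≫ ι_t` with `f_{s t} = ι_s ≫ f ≫ π_t` (`f : A^S → B^T`).
[cite: MumfordAV1970, §19 (p. 173)] [cite: JordanEtAl2018, §4.1] -/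
theorem eq_sum_matrix (hb : ∑ s, b.π s ≫ b.ι s = 𝟙 b.pt) (hc : ∑ t, c.π t ≫ c.ι t = 𝟙 c.pt) (f : b.pt ⟶ c.pt) :
    f = ∑ s, b.π s ≫ ∑ t, (b.ι s ≫ f ≫ c.π t) ≫ c.ι t := by
  conv_lhs => rw [eq_sum_π_comp_ι_comp b hb f]
  refine Finset.sum_congr rfl fun s _ ↦ ?_
  rw [eq_sum_comp_π_comp_ι c hc (b.ι s ≫ f)]
  simp only [Category.assoc]

/-- **Components of a matrix**: `ι_s ≫ (Σ_{s'} π_{s'} ≫ Σ_{t'} m_{s' t'} ≫ ι_{t'}) ≫ π_t = m_{s t}`. [cite: MumfordAV1970, §19 (p. 173)] -/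
theorem ι_comp_matrix_comp_π (m : S → T → (A ⟶ B)) (s : S) (t : T) :
    b.ι s ≫ (∑ s', b.π s' ≫ ∑ t', m s' t' ≫ c.ι t') ≫ c.π t = m s t := by
  rw [← Category.assoc, ι_comp_sum_π_comp b (fun s' ↦ ∑ t', m s' t' ≫ c.ι t') s, sum_comp_ι_comp_π c (m s) t]

/-- Maps between powers are determined by their matrices `ι_s ≫ f ≫ π_t`. [cite: MumfordAV1970, §19 (p. 173)] -/
theorem hom_ext_matrix (hb : ∑ s, b.π s ≫ b.ι s = 𝟙 b.pt) (hc : ∑ t, c.π t ≫ c.ι t = 𝟙 c.pt) {f g : b.pt ⟶ c.pt}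
    (h : ∀ s t, b.ι s ≫ f ≫ c.π t = b.ι s ≫ g ≫ c.π t) : f = g :=
  hom_ext_ι b hb fun s ↦ hom_ext_π c hc fun t ↦ by simpa only [Category.assoc] using h s t

end Components

/-! ## §2 The permutation action of `G` on `A^S`: `ι_s ≫ ρ(g) = ι_{g s}` -/

section PermAction

variable {A : AbelianVariety K} {S : Type} [Fintype S] (b : Bicone (fun _ : S ↦ A))
  {G : Type} [Group G] [MulAction G S] (ρ : G →* End b.pt)

/-- **The permutation action as a matrix**: `ρ(g) = Σ_s π_s ≫ ι_{g s}`. [cite: SerreLinearRepresentations1977, §1.2 (c) (`ρ_s e_x = e_{sx}`)] -/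
theorem asHom_permAction_eq_sum (hb : ∑ s, b.π s ≫ b.ι s = 𝟙 b.pt)
    (hρ : ∀ (g : G) (s : S), b.ι s ≫ End.asHom (ρ g) = b.ι (g • s)) (g : G) :
    End.asHom (ρ g) = ∑ s, b.π s ≫ b.ι (g • s) := by
  rw [eq_sum_π_comp_ι_comp b hb (End.asHom (ρ g))]
  simp only [hρ]

/-- **The projections are permuted contragrediently**: `ρ(g) ≫ π_{g t} = π_t`. [cite: SerreLinearRepresentations1977, §1.2 (c)] -/
theorem asHom_permAction_comp_π_smul (hb : ∑ s, b.π s ≫ b.ι s = 𝟙 b.pt)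
    (hρ : ∀ (g : G) (s : S), b.ι s ≫ End.asHom (ρ g) = b.ι (g • s)) (g : G) (t : S) :
    End.asHom (ρ g) ≫ b.π (g • t) = b.π t := by
  rw [asHom_permAction_eq_sum b ρ hb hρ g, Preadditive.sum_comp, Finset.sum_eq_single t]
  · rw [Category.assoc, bicone_ι_π_self]
    exact Category.comp_id _
  · intro s _ hst
    rw [Category.assoc, bicone_ι_π_ne b (fun h ↦ hst (smul_left_cancel g h)), comp_zero]
  · intro h
    exact absurd (Finset.mem_univ t) h

/-- `ρ(g) ≫ π_t = π_{g⁻¹ t}`. [cite: SerreLinearRepresentations1977, §1.2 (c)] -/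
theorem asHom_permAction_comp_π (hb : ∑ s, b.π s ≫ b.ι s = 𝟙 b.pt)
    (hρ : ∀ (g : G) (s : S), b.ι s ≫ End.asHom (ρ g) = b.ι (g • s)) (g : G) (t : S) :
    End.asHom (ρ g) ≫ b.π t = b.π (g⁻¹ • t) := by
  conv_lhs => rw [← smul_inv_smul g t]
  exact asHom_permAction_comp_π_smul b ρ hb hρ g (g⁻¹ • t)

omit [Fintype S] in
/-- **The matrix of `ρ(g)` is the permutation matrix**: `ι_s ≫ ρ(g) ≫ π_t = δ_{g s, t}`. [cite: SerreLinearRepresentations1977, §1.2 (c)] -/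
theorem ι_comp_asHom_permAction_comp_π [DecidableEq S] (hρ : ∀ (g : G) (s : S), b.ι s ≫ End.asHom (ρ g) = b.ι (g • s))
    (g : G) (s t : S) :
    b.ι s ≫ End.asHom (ρ g) ≫ b.π t = if g • s = t then 𝟙 A else 0 := by
  rw [← Category.assoc, hρ, bicone_ι_π_eq_ite]

/-- **Uniqueness of the permutation action**: an action with `ι_s ≫ ρ(g) = ι_{g s}` for all `g`, `s` is determined by this
property. [cite: SerreLinearRepresentations1977, §1.2 (c)] [cite: JordanEtAl2018, §4.1 (functoriality of `𝓗𝓞𝓜_R(−, E)`)] -/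
theorem permAction_unique (hb : ∑ s, b.π s ≫ b.ι s = 𝟙 b.pt) {ρ ρ' : G →* End b.pt}
    (hρ : ∀ (g : G) (s : S), b.ι s ≫ End.asHom (ρ g) = b.ι (g • s))
    (hρ' : ∀ (g : G) (s : S), b.ι s ≫ End.asHom (ρ' g) = b.ι (g • s)) : ρ = ρ' :=
  MonoidHom.ext fun g ↦ show End.asHom (ρ g) = End.asHom (ρ' g) from
    hom_ext_ι b hb fun s ↦ by rw [hρ, hρ']

/-- **Existence of the permutation action**: on every power `A^S` over a `G`-set `S` there is an action `ρ : G → End(A^S)`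
with `ι_s ≫ ρ(g) = ι_{g s}`, namely `ρ(g) = Σ_s π_s ≫ ι_{g s}` (a homomorphism: `ρ(1) = Σ_s π_s ≫ ι_s = 𝟙` and
`ρ(g h) = ρ(h) ≫ ρ(g)` by the component calculus).  This is the functor `𝓗𝓞𝓜_ℤ(−, A)` applied to the permutation module
`ℤ[S]` (`g ↦ (e_s ↦ e_{g s})`). [cite: SerreLinearRepresentations1977, §1.2 (c)] [cite: JordanEtAl2018, §4.1] -/
theorem exists_permAction (hb : ∑ s, b.π s ≫ b.ι s = 𝟙 b.pt) :
    ∃ ρ : G →* End b.pt, ∀ (g : G) (s : S), b.ι s ≫ End.asHom (ρ g) = b.ι (g • s) := by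
  have key : ∀ (g : G) (s : S), b.ι s ≫ (∑ s', b.π s' ≫ b.ι (g • s')) = b.ι (g • s) := fun g s ↦
    ι_comp_sum_π_comp b (fun s' ↦ b.ι (g • s')) s
  refine ⟨{ toFun := fun g ↦ End.of (∑ s, b.π s ≫ b.ι (g • s))
            map_one' := ?_
            map_mul' := ?_ }, fun g s ↦ key g s⟩
  · simp only [one_smul]
    exact hb
  · intro g h
    change (∑ s, b.π s ≫ b.ι ((g * h) • s)) = (∑ s, b.π s ≫ b.ι (h • s)) ≫ ∑ s, b.π s ≫ b.ι (g • s)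
    rw [Preadditive.sum_comp]
    refine Finset.sum_congr rfl fun s _ ↦ ?_
    rw [Category.assoc, key g (h • s), mul_smul]

end PermAction

/-! ## §3 Equivariance criteria: maps into / out of / between permutation powers -/

section Criteria

variable {A B X' Y : AbelianVariety K} {S : Type} [Fintype S] (b : Bicone (fun _ : S ↦ A))
  {T : Type} [Fintype T] (c : Bicone (fun _ : T ↦ B))
  {G : Type} [Group G] [MulAction G S] [MulAction G T]
  (ρ : G →* End b.pt) (ρc : G →* End c.pt) (ρ' : G →* End X') (ρY : G →* End Y)

/-- **Maps INTO a permutation power**: `f : X' → A^S` is `G`-equivariant (`ρ'(g) ≫ f = f ≫ ρ(g)`) iff its components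
`f_t = f ≫ π_t` satisfy **`ρ'(g) ≫ f_{g t} = f_t`**, i.e. `t ↦ f_t` is a `G`-map `S → Hom(X', A)` — the universal property
`Hom_G(C, 𝓗𝓞𝓜(ℤ[S], A)) = Hom_{ℤ[G]}(ℤ[S], Hom(C, A))` of the power object in `G`-objects.
[cite: JordanEtAl2018, §4.1 (`Hom(C, 𝓗𝓞𝓜_R(M, E)) ≅ Hom_R(M, Hom(C, E))`)] [cite: SerreLinearRepresentations1977, §1.2 (c)] -/
theorem permPower_comm_iff_target (hb : ∑ s, b.π s ≫ b.ι s = 𝟙 b.pt)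
    (hρ : ∀ (g : G) (s : S), b.ι s ≫ End.asHom (ρ g) = b.ι (g • s)) (f : X' ⟶ b.pt) :
    (∀ g : G, End.asHom (ρ' g) ≫ f = f ≫ End.asHom (ρ g)) ↔
      ∀ (g : G) (t : S), End.asHom (ρ' g) ≫ f ≫ b.π (g • t) = f ≫ b.π t := by
  constructor
  · intro h g t
    rw [← Category.assoc, h g, Category.assoc, asHom_permAction_comp_π_smul b ρ hb hρ g t]
  · intro h g
    refine hom_ext_π b hb fun t ↦ ?_
    rw [Category.assoc, Category.assoc, asHom_permAction_comp_π b ρ hb hρ g t]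
    have := h g (g⁻¹ • t)
    rwa [smul_inv_smul] at this

/-- **Maps OUT OF a permutation power**: `f : A^S → Y` is `G`-equivariant (`ρ(g) ≫ f = f ≫ ρ_Y(g)`) iff its components
`f^s = ι_s ≫ f` satisfy **`f^{g s} = f^s ≫ ρ_Y(g)`** (`s ↦ f^s` is a `G`-map `S → Hom(A, Y)`; the copower / induction side).
[cite: JordanEtAl2018, §4.1 and Remark 4.1 (`M ⊗_R E`)] [cite: SerreLinearRepresentations1977, §3.3 Ex. 2] -/
theorem permPower_comm_iff_source (hb : ∑ s, b.π s ≫ b.ι s = 𝟙 b.pt)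
    (hρ : ∀ (g : G) (s : S), b.ι s ≫ End.asHom (ρ g) = b.ι (g • s)) (f : b.pt ⟶ Y) :
    (∀ g : G, End.asHom (ρ g) ≫ f = f ≫ End.asHom (ρY g)) ↔
      ∀ (g : G) (s : S), b.ι (g • s) ≫ f = (b.ι s ≫ f) ≫ End.asHom (ρY g) := by
  constructor
  · intro h g s
    rw [← hρ g s, Category.assoc, h g, Category.assoc]
  · intro h g
    refine hom_ext_ι b hb fun s ↦ ?_
    rw [← Category.assoc, hρ g s, h g s, Category.assoc]

/-- **Maps BETWEEN permutation powers**: `f : A^S → B^T` is `G`-equivariant iff its matrix `f_{s t} = ι_s ≫ f ≫ π_t` is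
**constant on the `G`-orbits of `S × T`** (diagonal action): `f_{g s, g t} = f_{s, t}` — `Hom_G(A^S, B^T) =
Hom_{ℤ[G]}(ℤ[S] ⊗ ℤ[T], Hom(A, B))` with the trivial action on `Hom(A, B)`, and `ℤ[S] ⊗ ℤ[T] = ℤ[S × T]`.
[cite: SerreLinearRepresentations1977, §2.3 Ex. 2.6 (b) (the permutation representation on `X × X`, `s(x, y) = (sx, sy)`)]
[cite: JordanEtAl2018, §4.1] -/
theorem permPower_comm_iff (hb : ∑ s, b.π s ≫ b.ι s = 𝟙 b.pt) (hc : ∑ t, c.π t ≫ c.ι t = 𝟙 c.pt)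
    (hρ : ∀ (g : G) (s : S), b.ι s ≫ End.asHom (ρ g) = b.ι (g • s))
    (hρc : ∀ (g : G) (t : T), c.ι t ≫ End.asHom (ρc g) = c.ι (g • t)) (f : b.pt ⟶ c.pt) :
    (∀ g : G, End.asHom (ρ g) ≫ f = f ≫ End.asHom (ρc g)) ↔
      ∀ (g : G) (s : S) (t : T), b.ι (g • s) ≫ f ≫ c.π (g • t) = b.ι s ≫ f ≫ c.π t := by
  rw [permPower_comm_iff_source b ρ ρc hb hρ f]
  constructor
  · intro h g s t
    rw [← Category.assoc, h g s, Category.assoc, Category.assoc, asHom_permAction_comp_π_smul c ρc hc hρc g t]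
  · intro h g s
    refine hom_ext_π c hc fun t ↦ ?_
    rw [Category.assoc, Category.assoc, Category.assoc, asHom_permAction_comp_π c ρc hc hρc g t]
    have := h g s (g⁻¹ • t)
    rwa [smul_inv_smul] at this

/-- Membership form of `permPower_comm_iff`: `f ∈ Hom_G(A^S, B^T)` iff `ι_{g s} ≫ f ≫ π_{g t} = ι_s ≫ f ≫ π_t` for all `g, s, t`.
[cite: SerreLinearRepresentations1977, §2.3 Ex. 2.6 (b)] -/
theorem mem_equivariantHom_permPower_iff (hb : ∑ s, b.π s ≫ b.ι s = 𝟙 b.pt) (hc : ∑ t, c.π t ≫ c.ι t = 𝟙 c.pt)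
    (hρ : ∀ (g : G) (s : S), b.ι s ≫ End.asHom (ρ g) = b.ι (g • s))
    (hρc : ∀ (g : G) (t : T), c.ι t ≫ End.asHom (ρc g) = c.ι (g • t)) (f : b.pt ⟶ c.pt) :
    f ∈ (⨅ g : G, LinearMap.eqLocus (Preadditive.leftComp c.pt (End.asHom (ρ g))).toIntLinearMap
        (Preadditive.rightComp b.pt (End.asHom (ρc g))).toIntLinearMap : Submodule ℤ (b.pt ⟶ c.pt)) ↔
      ∀ (g : G) (s : S) (t : T), b.ι (g • s) ≫ f ≫ c.π (g • t) = b.ι s ≫ f ≫ c.π t := by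
  rw [mem_iInf_eqLocus_leftComp_rightComp_iff, permPower_comm_iff b c ρ ρc hb hc hρ hρc f]

/-- **`G`-invariant maps out of a permutation power**: `ρ(g) ≫ f = f` for all `g` iff the components `ι_s ≫ f` are CONSTANT ON
THE `G`-ORBITS of `S`. [cite: SerreLinearRepresentations1977, §2.3 Ex. 2.6 (a) (orbits)] -/
theorem permPower_source_invariant_iff (hb : ∑ s, b.π s ≫ b.ι s = 𝟙 b.pt)
    (hρ : ∀ (g : G) (s : S), b.ι s ≫ End.asHom (ρ g) = b.ι (g • s)) (f : b.pt ⟶ Y) :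
    (∀ g : G, End.asHom (ρ g) ≫ f = f) ↔ ∀ (g : G) (s : S), b.ι (g • s) ≫ f = b.ι s ≫ f := by
  have h := permPower_comm_iff_source b ρ (1 : G →* End Y) hb hρ f
  simp only [MonoidHom.one_apply, show End.asHom (1 : End Y) = 𝟙 Y from rfl, Category.comp_id] at h
  exact h

/-- **`G`-invariant maps into a permutation power** (for the right action `f ↦ f ≫ ρ(g)`): `f ≫ ρ(g) = f` for all `g` iff the
components `f ≫ π_t` are CONSTANT ON THE `G`-ORBITS of `T`. [cite: SerreLinearRepresentations1977, §2.3 Ex. 2.6 (a)] -/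
theorem permPower_target_invariant_iff (hc : ∑ t, c.π t ≫ c.ι t = 𝟙 c.pt)
    (hρc : ∀ (g : G) (t : T), c.ι t ≫ End.asHom (ρc g) = c.ι (g • t)) (f : X' ⟶ c.pt) :
    (∀ g : G, f ≫ End.asHom (ρc g) = f) ↔ ∀ (g : G) (t : T), f ≫ c.π (g • t) = f ≫ c.π t := by
  have h := permPower_comm_iff_target c ρc (1 : G →* End X') hc hρc f
  simp only [MonoidHom.one_apply, show End.asHom (1 : End X') = 𝟙 X' from rfl, Category.id_comp] at h
  rw [← h]
  exact forall_congr' fun g ↦ eq_comm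

end Criteria

/-! ## §4 Ranks: `rk_ℤ Hom_G(A^S, B^T) = |G\(S × T)| · rk_ℤ Hom(A, B)` and the invariant maps out of / into a power -/

section Ranks

variable {A B X' Y : AbelianVariety K} {S : Type} [Fintype S] (b : Bicone (fun _ : S ↦ A))
  {T : Type} [Fintype T] (c : Bicone (fun _ : T ↦ B))
  {G : Type} [Group G] [MulAction G S] [MulAction G T]
  (ρ : G →* End b.pt) (ρc : G →* End c.pt)

/-- **`rk_ℤ Hom_G(A^S, B^T) = |G\(S × T)| · rk_ℤ Hom(A, B)`** for the permutation actions on two powers over finite `G`-sets: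
an equivariant homomorphism is an ORBIT MATRIX — a function `G\(S × T) → Hom(A, B)` — and conversely (`f ↦ (f_{s t})`,
`m ↦ Σ_s π_s ≫ Σ_t m_{[s,t]} ≫ ι_t` are inverse additive bijections `Hom_G(A^S, B^T) ≅ Hom(A, B)^{G\(S × T)}`), and `Hom(A, B)`
is free of finite rank.  For `S = G/H`, `T = G/K` the orbits of `G` on `G/H × G/K` are the double cosets `H\G/K`
(Mackey: `dim Hom_G(Ind_H^G 1, Ind_K^G 1) = |H\G/K|`). [cite: SerreLinearRepresentations1977, §2.3 Ex. 2.6 (b) and §7.3 Prop. 22]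
[cite: JordanEtAl2018, §4.1] [cite: MumfordAV1970, §19 Thm. 3 (p. 176)] -/
theorem finrank_equivariantHom_permPower_eq (hb : ∑ s, b.π s ≫ b.ι s = 𝟙 b.pt) (hc : ∑ t, c.π t ≫ c.ι t = 𝟙 c.pt)
    (hρ : ∀ (g : G) (s : S), b.ι s ≫ End.asHom (ρ g) = b.ι (g • s))
    (hρc : ∀ (g : G) (t : T), c.ι t ≫ End.asHom (ρc g) = c.ι (g • t)) :
    Module.finrank ℤ (⨅ g : G, LinearMap.eqLocus (Preadditive.leftComp c.pt (End.asHom (ρ g))).toIntLinearMap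
        (Preadditive.rightComp b.pt (End.asHom (ρc g))).toIntLinearMap : Submodule ℤ (b.pt ⟶ c.pt)) =
      Nat.card (Quotient (MulAction.orbitRel G (S × T))) * Module.finrank ℤ (A ⟶ B) := by
  classical
  haveI : Module.Free ℤ (A ⟶ B) := module_free_hom_holds A B
  haveI : Module.Finite ℤ (A ⟶ B) := module_finite_hom_holds A B
  set V := (⨅ g : G, LinearMap.eqLocus (Preadditive.leftComp c.pt (End.asHom (ρ g))).toIntLinearMap
    (Preadditive.rightComp b.pt (End.asHom (ρc g))).toIntLinearMap : Submodule ℤ (b.pt ⟶ c.pt)) with hV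
  have mem := fun f ↦ mem_equivariantHom_permPower_iff b c ρ ρc hb hc hρ hρc f
  let Ω := Quotient (MulAction.orbitRel G (S × T))
  -- components of an equivariant map are constant on orbits
  have hconst : ∀ (f : V) (p q : S × T), p ∈ MulAction.orbit G q →
      b.ι p.1 ≫ (f : b.pt ⟶ c.pt) ≫ c.π p.2 = b.ι q.1 ≫ (f : b.pt ⟶ c.pt) ≫ c.π q.2 := by
    rintro f p q ⟨g, rfl⟩
    exact (mem _).1 f.2 g q.1 q.2
  let e : V ≃+ (Ω → (A ⟶ B)) :=
    { toFun := fun f ω ↦ b.ι ω.out.1 ≫ (f : b.pt ⟶ c.pt) ≫ c.π ω.out.2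
      invFun := fun m ↦ ⟨∑ s, b.π s ≫ ∑ t, m (Quotient.mk _ (s, t)) ≫ c.ι t, (mem _).2 fun g s t ↦ by
          rw [ι_comp_matrix_comp_π b c (fun s t ↦ m (Quotient.mk _ (s, t))) (g • s) (g • t),
            ι_comp_matrix_comp_π b c (fun s t ↦ m (Quotient.mk _ (s, t))) s t]
          exact congrArg m (Quotient.sound ⟨g, rfl⟩)⟩
      left_inv := fun f ↦ Subtype.ext (by
          change (∑ s, b.π s ≫ ∑ t, (b.ι (Quotient.mk (MulAction.orbitRel G (S × T)) (s, t)).out.1 ≫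
              (f : b.pt ⟶ c.pt) ≫ c.π (Quotient.mk (MulAction.orbitRel G (S × T)) (s, t)).out.2) ≫ c.ι t) =
            (f : b.pt ⟶ c.pt)
          conv_rhs => rw [eq_sum_matrix b c hb hc (f : b.pt ⟶ c.pt)]
          refine Finset.sum_congr rfl fun s _ ↦ ?_
          congr 1
          refine Finset.sum_congr rfl fun t _ ↦ ?_
          congr 1
          exact hconst f _ (s, t) (MulAction.orbitRel_apply.1 (Quotient.mk_out (s := MulAction.orbitRel G (S × T)) (s, t))))
      right_inv := fun m ↦ funext fun ω ↦ by
          change b.ι ω.out.1 ≫ (∑ s, b.π s ≫ ∑ t, m (Quotient.mk _ (s, t)) ≫ c.ι t) ≫ c.π ω.out.2 = m ω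
          rw [ι_comp_matrix_comp_π b c (fun s t ↦ m (Quotient.mk _ (s, t)))]
          exact congrArg m (Quotient.out_eq ω)
      map_add' := fun f f' ↦ funext fun ω ↦ by
          change b.ι ω.out.1 ≫ ((f : b.pt ⟶ c.pt) + (f' : b.pt ⟶ c.pt)) ≫ c.π ω.out.2 =
            b.ι ω.out.1 ≫ (f : b.pt ⟶ c.pt) ≫ c.π ω.out.2 + b.ι ω.out.1 ≫ (f' : b.pt ⟶ c.pt) ≫ c.π ω.out.2
          rw [Preadditive.add_comp, Preadditive.comp_add] }
  calc Module.finrank ℤ V = Module.finrank ℤ (Ω → (A ⟶ B)) := by convert e.toIntLinearEquiv.finrank_eq using 2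
    _ = Fintype.card Ω * Module.finrank ℤ (A ⟶ B) := by
        rw [Module.finrank_pi_fintype ℤ, Finset.sum_const, Finset.card_univ, smul_eq_mul]
    _ = Nat.card Ω * Module.finrank ℤ (A ⟶ B) := by rw [Nat.card_eq_fintype_card]

/-- **`rk_ℤ Hom(A^S, Y)^G = |G\S| · rk_ℤ Hom(A, Y)`** for the `G`-INVARIANT homomorphisms `{f : A^S → Y | ρ(g) ≫ f = f ∀ g}`
out of a permutation power (any abelian variety `Y`): such an `f` is a family of components `ι_s ≫ f ∈ Hom(A, Y)` constant on
the orbits, i.e. a homomorphism out of `A^{S/G}` ("`⟨χ_S, 1⟩ =` number of orbits").  Compare the bound `≤ 4 · dim B_G · dim Y` of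
`Motives/AbelianVarietyInvariantHomRank` valid for every action. [cite: SerreLinearRepresentations1977, §2.3 Ex. 2.6 (a)]
[cite: MumfordAV1970, §19 Thm. 3 (p. 176)] -/
theorem finrank_hom_permPower_source_invariant_eq (hb : ∑ s, b.π s ≫ b.ι s = 𝟙 b.pt)
    (hρ : ∀ (g : G) (s : S), b.ι s ≫ End.asHom (ρ g) = b.ι (g • s)) :
    Module.finrank ℤ (⨅ g : G, LinearMap.eqLocus (Preadditive.leftComp Y (End.asHom (ρ g))).toIntLinearMap LinearMap.id :
        Submodule ℤ (b.pt ⟶ Y)) =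
      Nat.card (Quotient (MulAction.orbitRel G S)) * Module.finrank ℤ (A ⟶ Y) := by
  classical
  haveI : Module.Free ℤ (A ⟶ Y) := module_free_hom_holds A Y
  haveI : Module.Finite ℤ (A ⟶ Y) := module_finite_hom_holds A Y
  set V := (⨅ g : G, LinearMap.eqLocus (Preadditive.leftComp Y (End.asHom (ρ g))).toIntLinearMap LinearMap.id :
    Submodule ℤ (b.pt ⟶ Y)) with hV
  have mem : ∀ f : b.pt ⟶ Y, f ∈ V ↔ ∀ (g : G) (s : S), b.ι (g • s) ≫ f = b.ι s ≫ f := fun f ↦ by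
    rw [hV, mem_iInf_eqLocus_leftComp_id_iff ρ f, permPower_source_invariant_iff b ρ hb hρ f]
  let Ω := Quotient (MulAction.orbitRel G S)
  have hconst : ∀ (f : V) (p q : S), p ∈ MulAction.orbit G q → b.ι p ≫ (f : b.pt ⟶ Y) = b.ι q ≫ (f : b.pt ⟶ Y) := by
    rintro f p q ⟨g, rfl⟩
    exact (mem _).1 f.2 g q
  let e : V ≃+ (Ω → (A ⟶ Y)) :=
    { toFun := fun f ω ↦ b.ι ω.out ≫ (f : b.pt ⟶ Y)
      invFun := fun m ↦ ⟨∑ s, b.π s ≫ m (Quotient.mk _ s), (mem _).2 fun g s ↦ by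
          rw [ι_comp_sum_π_comp b (fun s ↦ m (Quotient.mk _ s)) (g • s), ι_comp_sum_π_comp b (fun s ↦ m (Quotient.mk _ s)) s]
          exact congrArg m (Quotient.sound ⟨g, rfl⟩)⟩
      left_inv := fun f ↦ Subtype.ext (by
          change (∑ s, b.π s ≫ b.ι (Quotient.mk (MulAction.orbitRel G S) s).out ≫ (f : b.pt ⟶ Y)) = (f : b.pt ⟶ Y)
          conv_rhs => rw [eq_sum_π_comp_ι_comp b hb (f : b.pt ⟶ Y)]
          refine Finset.sum_congr rfl fun s _ ↦ ?_
          congr 1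
          exact hconst f _ s (MulAction.orbitRel_apply.1 (Quotient.mk_out (s := MulAction.orbitRel G S) s)))
      right_inv := fun m ↦ funext fun ω ↦ by
          change b.ι ω.out ≫ (∑ s, b.π s ≫ m (Quotient.mk _ s)) = m ω
          rw [ι_comp_sum_π_comp b (fun s ↦ m (Quotient.mk _ s))]
          exact congrArg m (Quotient.out_eq ω)
      map_add' := fun f f' ↦ funext fun ω ↦ by
          change b.ι ω.out ≫ ((f : b.pt ⟶ Y) + (f' : b.pt ⟶ Y)) = b.ι ω.out ≫ (f : b.pt ⟶ Y) + b.ι ω.out ≫ (f' : b.pt ⟶ Y)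
          rw [Preadditive.comp_add] }
  calc Module.finrank ℤ V = Module.finrank ℤ (Ω → (A ⟶ Y)) := by convert e.toIntLinearEquiv.finrank_eq using 2
    _ = Fintype.card Ω * Module.finrank ℤ (A ⟶ Y) := by
        rw [Module.finrank_pi_fintype ℤ, Finset.sum_const, Finset.card_univ, smul_eq_mul]
    _ = Nat.card Ω * Module.finrank ℤ (A ⟶ Y) := by rw [Nat.card_eq_fintype_card]

/-- **`rk_ℤ {f : X' → B^T | f ≫ ρ(g) = f ∀ g} = |G\T| · rk_ℤ Hom(X', B)`** for the maps into a permutation power invariant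
under the right action `f ↦ f ≫ ρ(g)` (any abelian variety `X'`): components `f ≫ π_t` constant on the orbits of `T`.
[cite: SerreLinearRepresentations1977, §2.3 Ex. 2.6 (a)] [cite: MumfordAV1970, §19 Thm. 3 (p. 176)] -/
theorem finrank_hom_permPower_target_invariant_eq (hc : ∑ t, c.π t ≫ c.ι t = 𝟙 c.pt)
    (hρc : ∀ (g : G) (t : T), c.ι t ≫ End.asHom (ρc g) = c.ι (g • t)) :
    Module.finrank ℤ (⨅ g : G, LinearMap.eqLocus (Preadditive.rightComp X' (End.asHom (ρc g))).toIntLinearMap LinearMap.id :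
        Submodule ℤ (X' ⟶ c.pt)) =
      Nat.card (Quotient (MulAction.orbitRel G T)) * Module.finrank ℤ (X' ⟶ B) := by
  classical
  haveI : Module.Free ℤ (X' ⟶ B) := module_free_hom_holds X' B
  haveI : Module.Finite ℤ (X' ⟶ B) := module_finite_hom_holds X' B
  set V := (⨅ g : G, LinearMap.eqLocus (Preadditive.rightComp X' (End.asHom (ρc g))).toIntLinearMap LinearMap.id :
    Submodule ℤ (X' ⟶ c.pt)) with hV
  have mem : ∀ f : X' ⟶ c.pt, f ∈ V ↔ ∀ (g : G) (t : T), f ≫ c.π (g • t) = f ≫ c.π t := fun f ↦ by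
    rw [hV, mem_iInf_eqLocus_rightComp_id_iff ρc f, permPower_target_invariant_iff c ρc hc hρc f]
  let Ω := Quotient (MulAction.orbitRel G T)
  have hconst : ∀ (f : V) (p q : T), p ∈ MulAction.orbit G q → (f : X' ⟶ c.pt) ≫ c.π p = (f : X' ⟶ c.pt) ≫ c.π q := by
    rintro f p q ⟨g, rfl⟩
    exact (mem _).1 f.2 g q
  let e : V ≃+ (Ω → (X' ⟶ B)) :=
    { toFun := fun f ω ↦ (f : X' ⟶ c.pt) ≫ c.π ω.out
      invFun := fun m ↦ ⟨∑ t, m (Quotient.mk _ t) ≫ c.ι t, (mem _).2 fun g t ↦ by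
          rw [sum_comp_ι_comp_π c (fun t ↦ m (Quotient.mk _ t)) (g • t), sum_comp_ι_comp_π c (fun t ↦ m (Quotient.mk _ t)) t]
          exact congrArg m (Quotient.sound ⟨g, rfl⟩)⟩
      left_inv := fun f ↦ Subtype.ext (by
          change (∑ t, ((f : X' ⟶ c.pt) ≫ c.π (Quotient.mk (MulAction.orbitRel G T) t).out) ≫ c.ι t) = (f : X' ⟶ c.pt)
          conv_rhs => rw [eq_sum_comp_π_comp_ι c hc (f : X' ⟶ c.pt)]
          refine Finset.sum_congr rfl fun t _ ↦ ?_
          congr 1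
          exact hconst f _ t (MulAction.orbitRel_apply.1 (Quotient.mk_out (s := MulAction.orbitRel G T) t)))
      right_inv := fun m ↦ funext fun ω ↦ by
          change (∑ t, m (Quotient.mk _ t) ≫ c.ι t) ≫ c.π ω.out = m ω
          rw [sum_comp_ι_comp_π c (fun t ↦ m (Quotient.mk _ t))]
          exact congrArg m (Quotient.out_eq ω)
      map_add' := fun f f' ↦ funext fun ω ↦ by
          change ((f : X' ⟶ c.pt) + (f' : X' ⟶ c.pt)) ≫ c.π ω.out = (f : X' ⟶ c.pt) ≫ c.π ω.out + (f' : X' ⟶ c.pt) ≫ c.π ω.out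
          rw [Preadditive.add_comp] }
  calc Module.finrank ℤ V = Module.finrank ℤ (Ω → (X' ⟶ B)) := by convert e.toIntLinearEquiv.finrank_eq using 2
    _ = Fintype.card Ω * Module.finrank ℤ (X' ⟶ B) := by
        rw [Module.finrank_pi_fintype ℤ, Finset.sum_const, Finset.card_univ, smul_eq_mul]
    _ = Nat.card Ω * Module.finrank ℤ (X' ⟶ B) := by rw [Nat.card_eq_fintype_card]

end Ranks

end AbelianVariety

end Literature.AlgebraicGeometry.Motives
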